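import Literature.NumberTheory.Automorphic.Liu2021.Def411WeilCarriersIrreducibleOfLemD1
import HarnessLib

/-!
# [Liu2021, Def. 4.11]'s «irreducible» for the constructed `ω(μ, ε, χ)`: the local inputs at ONE central character

Topic `NumberTheory/Automorphic/Liu2021`.  KERNEL ONLY: theorems; no definition, no record, no named fact, no `sorry`.

`Def411WeilCarriersIrreducibleOfLemD1` derives the END displays' `hirr` — `(rho … ι ε χ).IsIrreducible` — from the local
inputs «irreducible admissible» ([Liu2021, App. D Lem. D.1, first sentence l. 5227]) + survival of the unramified vector,
asked for EVERY continuous character `χ₁` of the centre `E¹(𝔸_{F,f})`.  That is more than the as-printed Lemma D.1 —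
whose `χ : E¹ → ℂ¹` is UNITARY (`LemD1Data.norm_chi`) — can supply.  This file sharpens the hypothesis to the ONE
character at which the question is decided: for a twist `χtw` of the compatible splitting `s_{lineOf ε}` against the
local reference section `s₀(𝓢)` (`pairSmall₁ s ∘ finPairToAdelic = s₀ ⊗ χtw`; such a `χtw` exists and is continuous,
`WeilCoinv.exists_twist_localRefSection_continuous`), the decisive character is
`χ₁(u) = χtw(1, u·1_W)⁻¹ · χ(u)`:

* `Def411WeilCarriers.rho_isIrreducible_of_lemD1_local_at_twist` — `TwistedCoinv` currency;
* `Def411WeilCarriers.rho_isIrreducible_of_irreducibleAdmissible_local_at_twist` (`n ≥ 3`) — the tree's Lem.-D.1 RECORD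
  currency `LocalOscillatorDatum.IrreducibleAdmissible` of `ofCentralChar (𝓢.omegaLoc v) (u ↦ u·1_n) _ χ_{1,v} n _`.

So a consumer holding Lemma D.1 only for unitary characters owes, besides the local models, only `‖χ₁(u)‖ = 1` for the
characters `χ₁` above (a property of `s`, `𝓢` and `χ`).  Nothing of [Liu2021] is asserted; HC_CM is not mentioned.

## References
* [Liu2021] Y. Liu, Camb. J. Math. 9 (2021) = arXiv:2102.11518: Def. 4.11 (l. 2083–2097), App. D §D.1 Steps 1∕2∕3
  (l. 5217∕5219∕5221), Lem. D.1 (l. 5227; (1) l. 5229 for non-vanishing).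
* [GelbartRogawski1991] S. Gelbart, J. Rogawski, Invent. Math. 105 (1991), §3.1 Remark p. 457 L4–13 (sections differ
  by a character).
* [Flath1979] D. Flath, PSPM 33 (1979) part 1, Thm. 2, Ex. 2.
-/

set_option autoImplicit false

noncomputable section

open scoped Matrix Kronecker TensorProduct Classical RestrictedProduct
open NumberField NumberField.mixedEmbedding IsDedekindDomain Filter Set
open Literature.NumberTheory.Automorphic Literature.NumberTheory.Automorphic.UnitaryGroup
open Literature.NumberTheory.Weil1964 Literature.RepresentationTheory
open Literature.RepresentationTheory.HeisenbergGroup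
open Literature.NumberTheory Literature.NumberTheory.GelbartRogawski1991
open Literature.NumberTheory.GelbartRogawski1991.UnitaryDualPair
open Literature.NumberTheory.GelbartRogawski1991.UnitaryDualPair.WeilCoinv

namespace Literature.NumberTheory.Automorphic.Liu2021.Def411WeilCarriers

variable (F E : Type) [Field F] [NumberField F] [Field E] [NumberField E] [Algebra F E]
variable (c : E ≃ₐ[F] E) (N : ℕ) {n : ℕ} (e : Fin N × Fin 1 ≃ Fin n)
variable (JV : Matrix (Fin N) (Fin N) E) {TV : Matrix (Fin N) (Fin N) F}
variable [Algebra.IsQuadraticExtension F E] {δ : E} (hcδ : c δ = -δ) (hδ : δ ≠ 0) {d : F}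
  (hd : δ * δ = algebraMap F E d) (hV : TV.IsSymm) (hVd : IsUnit TV.det) (hJV : JV = TV.map (algebraMap F E))
variable {s : ∀ a : Fˣ, UnitaryGroup.adelicPair F E c N 1 JV (JW F E a) →* adelicMpCont F (Fin n) (adelicGram F e TV (TW F a))}
  (hs : ∀ a : Fˣ, (splittingDatum F E c N 1 e JV (JW F E a) hcδ hδ hd hV (isSymm_TW F a) hVd (isUnit_det_TW F a) hJV
    (JW_eq F E a)).IsCompatible (s a))
  (hsc : ∀ a : Fˣ, Continuous (pairSplitting F E c N 1 e JV (JW F E a) (s a)))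
variable (ε : Eps F d) (χ : Chi F E c)
variable (𝓢 : LocalSplitting.FinLocalSplittings F E c n hcδ hδ hd (gram F e TV (TW F (lineOf F d ε)))
    (isSymm_gram F e hV (isSymm_TW F (lineOf F d ε)))
    (reindex_kronecker_eq_gram_map F E e hJV (JW_eq F E (lineOf F d ε))))
variable {G : Type*} [Group G] [TopologicalSpace G] {ι : G →* UnitaryGroup.finAdelic F E c N JV}
  (hι : Function.Surjective ι)

omit [TopologicalSpace G] in
include hsc hι in
/-- **The END displays' `hirr` from the local inputs at ONE central character.**  Let `s` be a compatible continuous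
splitting family, `ι` onto, `𝓢` local splittings of `U(J_V ⊗ (lineOf ε))(F_v)` (displayed DATA).  IF for every continuous
twist `χtw` of `s_{lineOf ε}` against the local reference section `s₀(𝓢)` (`pairSmall₁ s ∘ finPairToAdelic = s₀ ⊗ χtw`) and
the character `χ₁(u) = χtw(1, u·1_W)⁻¹ · χ(u)` of `E¹(𝔸_{F,f})`: (i) every local central quotient
`Coinv(ω_v ∘ (u ↦ u·1_n), χ_{1,v})` is an irreducible admissible representation of `U(J_V ⊗ (lineOf ε))(F_v)` ([Liu2021,
App. D Lem. D.1, first sentence l. 5227], read at `v`), and (ii) the class of `1_{𝒪_vⁿ}` is non-zero off a finite set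
(Def. 4.11's `⊗'` «unramified for all but finitely many `v`»), THEN `rho … ι ε χ` is irreducible.  (Such a twist exists:
`WeilCoinv.exists_twist_localRefSection_continuous`; the proof runs `omega_center_isIrreducible_of_local` at that `χ₁`.)
[cite: Liu2021, Def. 4.11 (l. 2092–2096), App. D §D.1 Step 3 (l. 5221), Lem. D.1 (l. 5227); GelbartRogawski1991, §3.1 Remark p. 457 L4–13; Flath1979, Theorem 2 / Example 2] -/
theorem rho_isIrreducible_of_lemD1_local_at_twist
    (hloc : ∀ χtw : UnitaryGroup.finAdelic F E c N JV × UnitaryGroup.finAdelic F E c 1 (JW F E (lineOf F d ε)) →* ℂˣ,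
      Continuous χtw →
      (pairSmall₁ F E c N 1 e JV (JW F E (lineOf F d ε)) (s (lineOf F d ε))).comp
          (finPairToAdelic F E c N 1 JV (JW F E (lineOf F d ε))) =
        adelicMpCont.twist F (Fin N × Fin 1) _
          (localRefSection F E c N 1 e JV (JW F E (lineOf F d ε)) hcδ hδ hd hV (isSymm_TW F _) hJV (JW_eq F E _) 𝓢)
          χtw →
      ∀ χ₁ : UnitaryGroup.finAdelicOne F E c →* ℂˣ,
        (∀ u, χ₁ u = (χtw (1, UnitaryGroup.finAdelicCenter F E c 1 (JW F E (lineOf F d ε)) u))⁻¹ * χ.1 u) →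
      (∀ v, (TwistedCoinv.rep (localCharOfCenter F E c (JW F E (lineOf F d ε)) (JW_apply_ne_zero F E _) χ₁ v)
            (𝓢.omegaLoc v)
            (commute_omegaLoc_localCenter F E c N e JV (JW F E (lineOf F d ε)) hcδ hδ hd hV (isSymm_TW F _) hJV
              (JW_eq F E _) (JW_apply_ne_zero F E _) 𝓢 v)).IsIrreducible ∧
          (TwistedCoinv.rep (localCharOfCenter F E c (JW F E (lineOf F d ε)) (JW_apply_ne_zero F E _) χ₁ v)
            (𝓢.omegaLoc v)
            (commute_omegaLoc_localCenter F E c N e JV (JW F E (lineOf F d ε)) hcδ hδ hd hV (isSymm_TW F _) hJV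
              (JW_eq F E _) (JW_apply_ne_zero F E _) 𝓢 v)).IsAdmissible) ∧
      ∃ S₁ : Finset (HeightOneSpectrum (𝓞 F)), ∀ v ∉ S₁,
        TwistedCoinv.mk (show Representation ℂ (UnitaryGroup.localPi E c 1 (JW F E (lineOf F d ε)) v) _ from
            (𝓢.omegaLoc v).comp (localCenter E c n (Matrix.reindex e e (JV ⊗ₖ JW F E (lineOf F d ε))) (JW F E (lineOf F d ε))
              (JW_apply_ne_zero F E _) v))
          (localCharOfCenter F E c (JW F E (lineOf F d ε)) (JW_apply_ne_zero F E _) χ₁ v) (unitVec F (Fin n) v) ≠ 0) :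
    (rho F E c N e JV hcδ hδ hd hV hVd hJV hs ι ε χ).IsIrreducible := by
  -- the twist between `s_{lineOf ε}` and the local reference section, continuous
  obtain ⟨χtw, hχtwc, hχtw⟩ := exists_twist_localRefSection_continuous F E c N 1 e JV (JW F E (lineOf F d ε)) hcδ hδ hd
    hV (isSymm_TW F _) hVd (isUnit_det_TW F _) hJV (JW_eq F E _) 𝓢 (hs (lineOf F d ε)) (hsc (lineOf F d ε))
  -- the decisive central character `χ₁ = χtw(1, u·1_W)⁻¹ · χ(u)` and its continuity
  have hχ₁c : Continuous (((χtw.comp (MonoidHom.inr _ _))⁻¹ * lineChar F E c (lineOf F d ε) χ.1).comp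
      (UnitaryGroup.finAdelicCenter F E c 1 (JW F E (lineOf F d ε)))) := by
    have h1 : Continuous fun u : UnitaryGroup.finAdelicOne F E c =>
        χtw (1, UnitaryGroup.finAdelicCenter F E c 1 (JW F E (lineOf F d ε)) u) :=
      hχtwc.comp (continuous_const.prodMk (continuous_finAdelicCenter F E c 1 _))
    have h2 : Continuous fun u : UnitaryGroup.finAdelicOne F E c => χ.1 u := χ.2.1
    refine ((h1.inv).mul h2).congr fun u => ?_
    simp only [Pi.mul_apply, Pi.inv_apply, MonoidHom.comp_apply, MonoidHom.mul_apply, MonoidHom.inv_apply,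
      MonoidHom.inr_apply, lineChar_finAdelicCenter]
  obtain ⟨h1, S₁, hS⟩ := hloc χtw hχtwc hχtw
    (((χtw.comp (MonoidHom.inr _ _))⁻¹ * lineChar F E c (lineOf F d ε) χ.1).comp
      (UnitaryGroup.finAdelicCenter F E c 1 (JW F E (lineOf F d ε))))
    (fun u => by
      simp only [MonoidHom.comp_apply, MonoidHom.mul_apply, MonoidHom.inv_apply, MonoidHom.inr_apply,
        lineChar_finAdelicCenter])
  refine (Representation.isIrreducible_comp_iff_of_surjective _ ι hι).2 ?_
  refine (isIrreducible_weilCoinv_iff_omega_center F E c N e JV (JW F E (lineOf F d ε)) hcδ hδ hd hV (isSymm_TW F _)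
    hVd (isUnit_det_TW F _) hJV (JW_eq F E _) 𝓢 (hs (lineOf F d ε)) hχtw
    (χ'' := (χtw.comp (MonoidHom.inr _ _))⁻¹ * lineChar F E c (lineOf F d ε) χ.1) (fun u => ?_)
    (JW_apply_ne_zero F E _)).2 ?_
  · rw [MonoidHom.mul_apply, MonoidHom.inv_apply, MonoidHom.comp_apply, MonoidHom.inr_apply, ← mul_assoc,
      mul_inv_cancel, one_mul]
  · exact omega_center_isIrreducible_of_local F E c N e JV (JW F E (lineOf F d ε)) hcδ hδ hd hV (isSymm_TW F _) hJV
      (JW_eq F E _) (JW_apply_ne_zero F E _) 𝓢 hχ₁c hS (fun v => (h1 v).1) (fun v => (h1 v).2)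

open scoped IsMulCommutative in
omit [TopologicalSpace G] in
include hsc hι in
/-- **The same in the tree's Lem.-D.1 RECORD currency** (`n ≥ 3`): hypothesis (i) is
`LocalOscillatorDatum.IrreducibleAdmissible` of the local datum `ofCentralChar (𝓢.omegaLoc v) (u ↦ u·1_n) _ χ_{1,v} n _`, asked
only at the characters `χ₁(u) = χtw(1, u·1_W)⁻¹ · χ(u)` of the twists `χtw` of `s_{lineOf ε}` against `s₀(𝓢)`.
[cite: Liu2021, Def. 4.11 (l. 2092–2096), App. D §D.1 Step 3 (l. 5221), Lem. D.1 (l. 5227; (1) l. 5229 for non-vanishing); GelbartRogawski1991, §3.1 Remark p. 457 L4–13; Flath1979, Theorem 2 / Example 2] -/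
theorem rho_isIrreducible_of_irreducibleAdmissible_local_at_twist (hn : 3 ≤ n)
    (hD1 : ∀ χtw : UnitaryGroup.finAdelic F E c N JV × UnitaryGroup.finAdelic F E c 1 (JW F E (lineOf F d ε)) →* ℂˣ,
      Continuous χtw →
      (pairSmall₁ F E c N 1 e JV (JW F E (lineOf F d ε)) (s (lineOf F d ε))).comp
          (finPairToAdelic F E c N 1 JV (JW F E (lineOf F d ε))) =
        adelicMpCont.twist F (Fin N × Fin 1) _
          (localRefSection F E c N 1 e JV (JW F E (lineOf F d ε)) hcδ hδ hd hV (isSymm_TW F _) hJV (JW_eq F E _) 𝓢)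
          χtw →
      ∀ χ₁ : UnitaryGroup.finAdelicOne F E c →* ℂˣ,
        (∀ u, χ₁ u = (χtw (1, UnitaryGroup.finAdelicCenter F E c 1 (JW F E (lineOf F d ε)) u))⁻¹ * χ.1 u) →
      (∀ v, (Literature.RepresentationTheory.Liu2021.LocalOscillatorDatum.ofCentralChar (𝓢.omegaLoc v)
          (localCenter E c n (Matrix.reindex e e (JV ⊗ₖ JW F E (lineOf F d ε))) (JW F E (lineOf F d ε))
            (JW_apply_ne_zero F E _) v)
          (localCenter_mem_center F E c (JW F E (lineOf F d ε)) n (Matrix.reindex e e (JV ⊗ₖ JW F E (lineOf F d ε)))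
            (JW_apply_ne_zero F E _) v)
          (localCharOfCenter F E c (JW F E (lineOf F d ε)) (JW_apply_ne_zero F E _) χ₁ v) n
          (Nat.le_of_succ_le hn)).IrreducibleAdmissible) ∧
      ∃ S₁ : Finset (HeightOneSpectrum (𝓞 F)), ∀ v ∉ S₁,
        TwistedCoinv.mk (show Representation ℂ (UnitaryGroup.localPi E c 1 (JW F E (lineOf F d ε)) v) _ from
            (𝓢.omegaLoc v).comp (localCenter E c n (Matrix.reindex e e (JV ⊗ₖ JW F E (lineOf F d ε))) (JW F E (lineOf F d ε))
              (JW_apply_ne_zero F E _) v))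
          (localCharOfCenter F E c (JW F E (lineOf F d ε)) (JW_apply_ne_zero F E _) χ₁ v) (unitVec F (Fin n) v) ≠ 0) :
    (rho F E c N e JV hcδ hδ hd hV hVd hJV hs ι ε χ).IsIrreducible :=
  rho_isIrreducible_of_lemD1_local_at_twist F E c N e JV hcδ hδ hd hV hVd hJV hs hsc ε χ 𝓢 hι
    fun χtw hχtwc hχtw χ₁ hχ₁ => by
      obtain ⟨h1, hS⟩ := hD1 χtw hχtwc hχtw χ₁ hχ₁
      exact ⟨fun v => twistedCoinv_isIrreducible_and_isAdmissible_of_irreducibleAdmissible F E c N e JV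
        (JW F E (lineOf F d ε)) hcδ hδ hd hV (isSymm_TW F _) hJV (JW_eq F E _) (JW_apply_ne_zero F E _) 𝓢 hn v _ (h1 v),
        hS⟩

end Literature.NumberTheory.Automorphic.Liu2021.Def411WeilCarriers

end
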